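import Summits.HodgeConjecture.HodgeConjecture.Theorems.Ring2AbelianAllWeilBaseChangeQuartic
import Literature.AlgebraicGeometry.HodgeTheory.WeilClassesTwistedSquare
import Literature.AlgebraicGeometry.HodgeTheory.WeilClassesMoonenZarhinCriterion
import Mathlib.Tactic.Module
import HarnessLib

/-!
# Ring 2 · AbelianAll (ab-weil-1, gen 139, part BC-b) — the base change `B = A × A`,
  `θ = (φ × φ) + S`, and the `E`-Weil classes of `B` built from the `K`-Weil classes of `A`

research route conditional on HC_CM; not a corollary; Q11.4-sentence-2 already refuted in dim ≥ 3.
`HC_CM` (`Theses.RankFourFaces.CMAbelianHodge`) does not occur in this file and no open case of the Hodge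
conjecture is claimed. This is the GEOMETRIC layer of the kernel proof of LEMMA BC
(`Ring2AbelianAllWeilBaseChangeRestriction.weilBaseChangeRestriction_holds`; bears on H2 → H1, i.e. rung R3
`WeilClassesCMField` ⟹ rung R∞ `WeilClassesImaginaryQuadratic`), on the tree's real carriers
(`Motives.AbelianVariety.prod`, `complexBetti`, `pullbackEigenclasses`, `weilClassesField`, `cupPowOne`).

## What is proved (0 sorry)

Let `A` be a complex abelian variety with `φ : A ⟶ A`, `φ ≫ φ = -(d • 𝟙 A)` (`K = ℚ(√-d)` acts), `B := A × A`
(`A.prod A`) with projections `p₁, p₂`, and `θ := prodLift (p₁ ≫ φ + 2 • p₂) (p₁ + p₂ ≫ φ) : B ⟶ B`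
("`θ(u, v) = (φu + 2v, u + φv)`", i.e. `θ = φ × φ + S`, `S(u, v) = (2v, u)`, `S² = 2`).
* §1 `θ² = N + (2 − d)`, `N² = −8d` with `N(u, v) = (4φv, 2φu)` (`bcTheta_comp_bcTheta`, `bcN_comp_bcN`), hence
  `P_d(θ) = θ⁴ + (2d − 4)θ² + (d + 2)² = 0` in `End B` (`bcTheta_quartic`), in the literal `eval₂` shape of rung
  R3 (`eval₂_bcTheta_bcQuartic`): the biquadratic CM field `E = ℚ[T]/(P_d) = K(√2)` acts on `B = A ⊗_K E`.
  The maps `g_m := p₁ + m • p₂ : B ⟶ A` and `i := (𝟙, 0) : A ⟶ B` with `i ≫ g_m = 𝟙` (`bcIncl_bcProj`).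
* §2 EIGENVECTORS: if `φ^* v = ν v` on `H¹(A; ℂ)` and `σ² = 2`, then `p₁^* v + σ p₂^* v` is a `θ^*`-eigenvector
  of eigenvalue `ν + σ` (`bcTheta_eigenvector`); so for `a₁, …, a_k ∈ V_ν` the wedge
  `w_σ(a) := ∏ (p₁^* aᵢ + σ p₂^* aᵢ)` lies in the eigenclass space of the character `(x + y(ν + σ))^k`, which is
  inside `weilClassesField B θ P_d k` when `ν² = −d` (`cupPowOne_baseChange_mem_weilClassesField`).
* §3 EXPANSIONS over subsets `s ⊆ Fin k` with `τ_s(a) := ∏_{i ∈ s} p₁^* aᵢ · ∏_{i ∉ s} p₂^* aᵢ`: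
  `g_m^*(∏ aᵢ) = Σ_s m^{|sᶜ|} τ_s(a)` (`map_bcProj_cupPowOne`) and `w_σ(a) = Σ_s σ^{|sᶜ|} τ_s(a)`
  (`cupPowOne_baseChange_eq_sum`).
* §4 GENERATORS of the Weil plane of `A` (`dim A = 2n`): eigenbases `a` of `V₊ = V_{i√d}`, `b` of `V₋` with
  `α := ∏ aᵢ ≠ 0`, `β := ∏ bⱼ ≠ 0` (`exists_eigenbases`, from `H•(A) = ⋀•H¹(A)`), `α ∈ E₊`, `β ∈ E₋`
  (`cupPowOne_mem_weilClassesPlus/Minus`); with `AbelianVarietyEndomorphismsHOne.weilClassesPlus_le_span_singleton`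
  every class of `weilClassesOf A φ n d = E₊ ⊔ E₋` is `t α + t' β`.

What is NOT proved or claimed: the lift and LEMMA BC itself (part BC-c); no Literature fact is introduced; no
internally-minted statement is cited as a fact.

## References

* [vanGeemen1994HodgeAV] B. van Geemen, An introduction to the Hodge conjecture for abelian varieties,
  LNM 1594 (1994), 4.8–4.12.
* [MoonenZarhin1998WeilClasses] B. Moonen, Yu. Zarhin, Weil classes on abelian varieties,
  J. reine angew. Math. 496 (1998), §1.
* [LangeBirkenhake1992] H. Lange, Ch. Birkenhake, Complex abelian varieties, Grundlehren 302 (1992), §1.1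
  (`H•(A; ℂ) = ⋀• H¹`).
-/

noncomputable section

set_option linter.dupNamespace false

open CategoryTheory
open scoped BigOperators
open Literature.AlgebraicGeometry Literature.AlgebraicGeometry.Motives
open Literature.AlgebraicGeometry.HodgeTheory
open Literature.AlgebraicTopology.SingularHomology

namespace Summit.HodgeConjecture.HodgeConjecture.Ring2.AbelianAll

variable {A : AbelianVariety ℂ} {d : ℕ}

/-! ### §1 `B = A × A`, `θ = (φ × φ) + S`, `P_d(θ) = 0`; the maps `g_m`, `i` -/

section Theta

variable (φ : A ⟶ A)

/-- `θ(u, v) = (φu + 2v, u + φv)` on `B = A × A`: `θ = φ × φ + S`, `S(u, v) = (2v, u)`, `S² = 2`. -/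
def bcTheta : A.prod A ⟶ A.prod A :=
  AbelianVariety.prodLift (AbelianVariety.fst A A ≫ φ + 2 • AbelianVariety.snd A A)
    (AbelianVariety.fst A A + AbelianVariety.snd A A ≫ φ)

/-- `N(u, v) = (4φv, 2φu)` (`= 2 · S ∘ (φ × φ)`, so `θ² = N + (2 − d)`). -/
def bcN : A.prod A ⟶ A.prod A :=
  AbelianVariety.prodLift (4 • (AbelianVariety.snd A A ≫ φ)) (2 • (AbelianVariety.fst A A ≫ φ))

variable (A) in
/-- `g_m = p₁ + m • p₂ : A × A ⟶ A`. -/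
def bcProj (m : ℕ) : A.prod A ⟶ A := AbelianVariety.fst A A + m • AbelianVariety.snd A A

variable (A) in
/-- `i = (𝟙, 0) : A ⟶ A × A`, the first-factor inclusion. -/
def bcIncl : A ⟶ A.prod A := AbelianVariety.prodLift (𝟙 A) 0

/-- First component of `θ`: `p₁ ∘ θ = φ ∘ p₁ + 2·p₂`. -/
theorem bcTheta_fst : bcTheta φ ≫ AbelianVariety.fst A A =
    AbelianVariety.fst A A ≫ φ + 2 • AbelianVariety.snd A A := AbelianVariety.prodLift_fst _ _

/-- Second component of `θ`: `p₂ ∘ θ = p₁ + φ ∘ p₂`. -/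
theorem bcTheta_snd : bcTheta φ ≫ AbelianVariety.snd A A =
    AbelianVariety.fst A A + AbelianVariety.snd A A ≫ φ := AbelianVariety.prodLift_snd _ _

/-- First component of `N`: `p₁ ∘ N = 4·(φ ∘ p₂)`. -/
theorem bcN_fst : bcN φ ≫ AbelianVariety.fst A A = 4 • (AbelianVariety.snd A A ≫ φ) :=
  AbelianVariety.prodLift_fst _ _

/-- Second component of `N`: `p₂ ∘ N = 2·(φ ∘ p₁)`. -/
theorem bcN_snd : bcN φ ≫ AbelianVariety.snd A A = 2 • (AbelianVariety.fst A A ≫ φ) :=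
  AbelianVariety.prodLift_snd _ _

/-- `θ² = N + (2 − d)`. -/
theorem bcTheta_comp_bcTheta (hφ : φ ≫ φ = -(d • 𝟙 A)) :
    bcTheta φ ≫ bcTheta φ = bcN φ + (2 - (d : ℤ)) • 𝟙 (A.prod A) := by
  apply AbelianVariety.prod_hom_ext
  · rw [Category.assoc, bcTheta_fst, Preadditive.comp_add, Preadditive.comp_nsmul, bcTheta_snd,
      ← Category.assoc, bcTheta_fst, Preadditive.add_comp, Preadditive.nsmul_comp, Category.assoc, hφ,
      Preadditive.add_comp, bcN_fst, Preadditive.zsmul_comp, Category.id_comp, Preadditive.comp_neg,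
      Preadditive.comp_nsmul, Category.comp_id]
    module
  · rw [Category.assoc, bcTheta_snd, Preadditive.comp_add, bcTheta_fst, ← Category.assoc, bcTheta_snd,
      Preadditive.add_comp, Category.assoc, hφ, Preadditive.add_comp, bcN_snd, Preadditive.zsmul_comp,
      Category.id_comp, Preadditive.comp_neg, Preadditive.comp_nsmul, Category.comp_id]
    module

/-- `N² = −8d`. -/
theorem bcN_comp_bcN (hφ : φ ≫ φ = -(d • 𝟙 A)) :
    bcN φ ≫ bcN φ = (-(8 * (d : ℤ))) • 𝟙 (A.prod A) := by
  apply AbelianVariety.prod_hom_ext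
  · rw [Category.assoc, bcN_fst, Preadditive.comp_nsmul, ← Category.assoc, bcN_snd, Preadditive.nsmul_comp,
      Category.assoc, hφ, Preadditive.zsmul_comp, Category.id_comp, Preadditive.comp_neg,
      Preadditive.comp_nsmul, Category.comp_id]
    module
  · rw [Category.assoc, bcN_snd, Preadditive.comp_nsmul, ← Category.assoc, bcN_fst, Preadditive.nsmul_comp,
      Category.assoc, hφ, Preadditive.zsmul_comp, Category.id_comp, Preadditive.comp_neg,
      Preadditive.comp_nsmul, Category.comp_id]
    module

/-- Ring form: `θ² = N + (2 − d)` in `End (A × A)`. -/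
theorem bcTheta_sq_End (hφ : φ ≫ φ = -(d • 𝟙 A)) :
    End.of (bcTheta φ) * End.of (bcTheta φ) =
      End.of (bcN φ) + (2 - (d : ℤ)) • (1 : End (A.prod A)) := by
  show bcTheta φ ≫ bcTheta φ = bcN φ + (2 - (d : ℤ)) • 𝟙 (A.prod A)
  exact bcTheta_comp_bcTheta φ hφ

/-- Ring form: `N² = −8d` in `End (A × A)`. -/
theorem bcN_sq_End (hφ : φ ≫ φ = -(d • 𝟙 A)) :
    End.of (bcN φ) * End.of (bcN φ) = (-(8 * (d : ℤ))) • (1 : End (A.prod A)) := by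
  show bcN φ ≫ bcN φ = (-(8 * (d : ℤ))) • 𝟙 (A.prod A)
  exact bcN_comp_bcN φ hφ

/-- **`P_d(θ) = 0`**: `θ⁴ + (2d − 4)θ² + (d + 2)² = 0` in the ring `End (A × A)`. -/
theorem bcTheta_quartic (hφ : φ ≫ φ = -(d • 𝟙 A)) :
    End.of (bcTheta φ) ^ 4 + ((2 * (d : ℤ) - 4 : ℤ) : End (A.prod A)) * End.of (bcTheta φ) ^ 2
      + ((((d : ℤ) + 2) ^ 2 : ℤ) : End (A.prod A)) = 0 := by
  set θ : End (A.prod A) := End.of (bcTheta φ)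
  set N : End (A.prod A) := End.of (bcN φ)
  have hθ : θ * θ = N + (2 - (d : ℤ)) • (1 : End (A.prod A)) := bcTheta_sq_End φ hφ
  have hN : N * N = (-(8 * (d : ℤ))) • (1 : End (A.prod A)) := bcN_sq_End φ hφ
  rw [← zsmul_eq_mul, ← zsmul_one (((d : ℤ) + 2) ^ 2), show (4 : ℕ) = 2 + 2 from rfl, pow_add, pow_two, hθ]
  simp only [mul_add, add_mul, hN, mul_smul_comm, smul_mul_assoc, mul_one, one_mul, smul_add, smul_smul]
  module

/-- **`P_d(θ) = 0` in the literal `eval₂` shape of rung R3** (`θ : B ⟶ B` read in `End B`). -/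
theorem eval₂_bcTheta_bcQuartic (hφ : φ ≫ φ = -(d • 𝟙 A)) :
    Polynomial.eval₂ (Int.castRingHom (CategoryTheory.End (A.prod A)))
      (bcTheta φ : CategoryTheory.End (A.prod A)) (bcQuartic d) = 0 := by
  rw [eval₂_bcQuartic]
  exact bcTheta_quartic φ hφ

/-- `i ≫ g_m = 𝟙 A`. -/
theorem bcIncl_bcProj (m : ℕ) : bcIncl A ≫ bcProj A m = 𝟙 A := by
  rw [bcProj, Preadditive.comp_add, Preadditive.comp_nsmul, bcIncl, AbelianVariety.prodLift_fst,
    AbelianVariety.prodLift_snd, smul_zero, add_zero]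

/-- `i^* ∘ g_m^* = id` on `Hᵏ(A; ℂ)`. -/
theorem map_bcIncl_map_bcProj (m k : ℕ) (c : complexBetti A.X k) :
    complexBetti.map (bcIncl A).hom.hom.hom k (complexBetti.map (bcProj A m).hom.hom.hom k c) = c := by
  rw [complexBetti_map_map_hom, bcIncl_bcProj]
  exact abelianVariety_map_id_apply c

end Theta

/-! ### §2 Eigenvectors of `θ^*` on `H¹(B)` and the `E`-Weil classes `w_σ(a)` -/

section Eigen

variable (φ : A ⟶ A)

/-- **Eigenvectors of `θ^*`**: for `φ^* v = ν v` and `σ² = 2`, `θ^*(p₁^* v + σ p₂^* v) = (ν + σ)(p₁^* v + σ p₂^* v)`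
(`θ ≫ p₁ = p₁ ≫ φ + 2 p₂`, `θ ≫ p₂ = p₁ + p₂ ≫ φ`). -/
theorem bcTheta_eigenvector {ν σ : ℂ} (hσ : σ ^ 2 = 2) {v : complexBetti A.X 1}
    (hv : v ∈ Module.End.eigenspace (complexBetti.map φ.hom.hom.hom 1).hom ν) :
    complexBetti.map (AbelianVariety.fst A A).hom.hom.hom 1 v +
        σ • complexBetti.map (AbelianVariety.snd A A).hom.hom.hom 1 v ∈
      Module.End.eigenspace (complexBetti.map (bcTheta φ).hom.hom.hom 1).hom (ν + σ) := by
  have hv' := Module.End.mem_eigenspace_iff.mp hv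
  set P := complexBetti.map (AbelianVariety.fst A A).hom.hom.hom 1 v with hP
  set Q := complexBetti.map (AbelianVariety.snd A A).hom.hom.hom 1 v with hQ
  have h1 : complexBetti.map (bcTheta φ).hom.hom.hom 1 P = ν • P + (2 : ℕ) • Q := by
    rw [hP, complexBetti_map_map_hom, bcTheta_fst, complexBetti_map_add_deg_one,
      complexBetti_map_nsmul_deg_one, ← complexBetti_map_map_hom]
    change complexBetti.map (AbelianVariety.fst A A).hom.hom.hom 1
      ((complexBetti.map φ.hom.hom.hom 1).hom v) + _ = _
    rw [hv', map_smul]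
  have h2 : complexBetti.map (bcTheta φ).hom.hom.hom 1 Q = P + ν • Q := by
    rw [hQ, complexBetti_map_map_hom, bcTheta_snd, complexBetti_map_add_deg_one, ← complexBetti_map_map_hom]
    change _ + complexBetti.map (AbelianVariety.snd A A).hom.hom.hom 1
      ((complexBetti.map φ.hom.hom.hom 1).hom v) = _
    rw [hv', map_smul]
  rw [Module.End.mem_eigenspace_iff, map_add, map_smul]
  change complexBetti.map (bcTheta φ).hom.hom.hom 1 P + σ • complexBetti.map (bcTheta φ).hom.hom.hom 1 Q = _
  rw [h1, h2]
  have h2Q : (2 : ℕ) • Q = (σ ^ 2) • Q := by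
    rw [hσ, ← Nat.cast_smul_eq_nsmul ℂ, Nat.cast_ofNat]
  rw [h2Q]
  module

/-- The base-changed wedge `w_σ(a) = ∏ᵢ (p₁^* aᵢ + σ p₂^* aᵢ)` of `a₁, …, a_k ∈ V_ν` lies in the eigenclass
space of the character `(x + y(ν + σ))^k` of `ℕ[θ]`. -/
theorem cupPowOne_baseChange_mem_pullbackEigenclasses {ν σ : ℂ} (hσ : σ ^ 2 = 2)
    {k : ℕ} {a : Fin k → complexBetti A.X 1}
    (ha : ∀ i, a i ∈ Module.End.eigenspace (complexBetti.map φ.hom.hom.hom 1).hom ν) :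
    cupPowOne ℂ (ComplexPoints (A.prod A).X) k
        (fun i => complexBetti.map (AbelianVariety.fst A A).hom.hom.hom 1 (a i) +
          σ • complexBetti.map (AbelianVariety.snd A A).hom.hom.hom 1 (a i)) ∈
      pullbackEigenclasses (A.prod A) (bcTheta φ) k (fun x y : ℕ => ((x : ℂ) + (y : ℂ) * (ν + σ)) ^ k) := by
  have h := cupPowOne_mem_pullbackEigenclasses (A := A.prod A) (φ := bcTheta φ) (lam := fun _ => ν + σ)
    (fun i => bcTheta_eigenvector φ hσ (ha i))
  have e : (fun x y : ℕ => ∏ _i : Fin k, ((x : ℂ) + (y : ℂ) * (ν + σ))) =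
      fun x y : ℕ => ((x : ℂ) + (y : ℂ) * (ν + σ)) ^ k := by
    funext x y; rw [Finset.prod_const, Finset.card_univ, Fintype.card_fin]
  rw [e] at h
  exact h

/-- **`w_σ(a) ∈ W_E(B) = weilClassesField B θ P_d k`** when `ν² = −d`, `σ² = 2` (`ν + σ` is a root of `P_d`). -/
theorem cupPowOne_baseChange_mem_weilClassesField {ν σ : ℂ} (hν : ν ^ 2 = -(d : ℂ)) (hσ : σ ^ 2 = 2)
    {k : ℕ} {a : Fin k → complexBetti A.X 1}
    (ha : ∀ i, a i ∈ Module.End.eigenspace (complexBetti.map φ.hom.hom.hom 1).hom ν) :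
    cupPowOne ℂ (ComplexPoints (A.prod A).X) k
        (fun i => complexBetti.map (AbelianVariety.fst A A).hom.hom.hom 1 (a i) +
          σ • complexBetti.map (AbelianVariety.snd A A).hom.hom.hom 1 (a i)) ∈
      weilClassesField (A.prod A) (bcTheta φ) (bcQuartic d) k :=
  pullbackEigenclasses_le_weilClassesField (bcQuartic_root d hν hσ)
    (cupPowOne_baseChange_mem_pullbackEigenclasses φ hσ ha)

end Eigen

/-! ### §3 Expansions over subsets -/

section Expansion

/-- `τ_s(a) := ∏_{i ∈ s} p₁^* aᵢ · ∏_{i ∉ s} p₂^* aᵢ ∈ Hᵏ(A × A; ℂ)`: the wedge with `p₁^* aᵢ` at the places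
`i ∈ s` and `p₂^* aᵢ` at the places `i ∉ s`. -/
def bcTau {k : ℕ} (a : Fin k → complexBetti A.X 1) (s : Finset (Fin k)) : complexBetti (A.prod A).X k :=
  cupPowOne ℂ (ComplexPoints (A.prod A).X) k
    (s.piecewise (fun i => complexBetti.map (AbelianVariety.fst A A).hom.hom.hom 1 (a i))
      (fun i => complexBetti.map (AbelianVariety.snd A A).hom.hom.hom 1 (a i)))

/-- **Pull-back of a wedge along `g_m = p₁ + m p₂`**: `g_m^*(∏ aᵢ) = Σ_s m^{|sᶜ|} τ_s(a)`. -/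
theorem map_bcProj_cupPowOne (m k : ℕ) (a : Fin k → complexBetti A.X 1) :
    complexBetti.map (bcProj A m).hom.hom.hom k (cupPowOne ℂ (ComplexPoints A.X) k a) =
      ∑ s : Finset (Fin k), (m : ℂ) ^ sᶜ.card • bcTau a s := by
  classical
  rw [complexBetti_map_cupPowOne]
  have e : (fun i => complexBetti.map (bcProj A m).hom.hom.hom 1 (a i)) =
      (fun i => complexBetti.map (AbelianVariety.fst A A).hom.hom.hom 1 (a i)) +
        (m : ℂ) • (fun i => complexBetti.map (AbelianVariety.snd A A).hom.hom.hom 1 (a i)) := by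
    funext i
    rw [bcProj, complexBetti_map_add_deg_one, complexBetti_map_nsmul_deg_one, ← Nat.cast_smul_eq_nsmul ℂ]
    rfl
  rw [e, multilinear_apply_add_smul]
  rfl

/-- **The base-changed wedge over subsets**: `w_σ(a) = Σ_s σ^{|sᶜ|} τ_s(a)`. -/
theorem cupPowOne_baseChange_eq_sum (σ : ℂ) (k : ℕ) (a : Fin k → complexBetti A.X 1) :
    cupPowOne ℂ (ComplexPoints (A.prod A).X) k
        (fun i => complexBetti.map (AbelianVariety.fst A A).hom.hom.hom 1 (a i) +
          σ • complexBetti.map (AbelianVariety.snd A A).hom.hom.hom 1 (a i)) =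
      ∑ s : Finset (Fin k), σ ^ sᶜ.card • bcTau a s := by
  classical
  have e : (fun i => complexBetti.map (AbelianVariety.fst A A).hom.hom.hom 1 (a i) +
      σ • complexBetti.map (AbelianVariety.snd A A).hom.hom.hom 1 (a i)) =
      (fun i => complexBetti.map (AbelianVariety.fst A A).hom.hom.hom 1 (a i)) +
        σ • (fun i => complexBetti.map (AbelianVariety.snd A A).hom.hom.hom 1 (a i)) := rfl
  rw [e, multilinear_apply_add_smul]
  rfl

end Expansion

/-! ### §4 Eigenbases of `V±(A)` and the generators `α ∈ E₊`, `β ∈ E₋` of the Weil plane -/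

section Generators

variable (φ : A ⟶ A) {n : ℕ}

/-- **Eigenbases with non-zero top wedges**: for `dim A = 2n`, `φ² = −d`, `d ≥ 1`, bases `a` of `V₊ = V_{i√d}`
and `b` of `V₋ = V_{−i√d}` (each of dimension `2n`) with `∏ aᵢ ≠ 0 ≠ ∏ bⱼ` in `H^{2n}(A; ℂ)` — indeed
`(∏ aᵢ) ⌣ (∏ bⱼ)` is the top wedge of a basis of `H¹`, non-zero since `H•(A; ℂ) = ⋀• H¹`. -/
theorem exists_eigenbases (hA : A.dim = 2 * n) (hd : 0 < d) (hφ : φ ≫ φ = -(d • 𝟙 A)) :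
    ∃ a b : Fin (2 * n) → complexBetti A.X 1,
      (∀ i, a i ∈ Module.End.eigenspace (complexBetti.map φ.hom.hom.hom 1).hom
        (Complex.I * (Real.sqrt d : ℂ))) ∧
      (∀ j, b j ∈ Module.End.eigenspace (complexBetti.map φ.hom.hom.hom 1).hom
        (-(Complex.I * (Real.sqrt d : ℂ)))) ∧
      cupPowOne ℂ (ComplexPoints A.X) (2 * n) a ≠ 0 ∧ cupPowOne ℂ (ComplexPoints A.X) (2 * n) b ≠ 0 := by
  classical
  have hΛ : HasExteriorCohomologyH1 ℂ (ComplexPoints A.X) :=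
    AbelianVariety.hasExteriorCohomologyH1_complexPoints A
  haveI := finite_complexBetti_abelianVariety A 1
  have hb₁ : Module.finrank ℂ (complexBetti A.X 1) = 2 * (2 * n) := by
    rw [AbelianVariety.finrank_complexBetti_one, hA]
  have hp : Module.finrank ℂ (Module.End.eigenspace (complexBetti.map φ.hom.hom.hom 1).hom
      (Complex.I * (Real.sqrt d : ℂ))) = 2 * n := by
    have h := two_mul_finrank_eigenspace_eq hd hφ
    rw [hb₁] at h
    omega
  have hq : Module.finrank ℂ (Module.End.eigenspace (complexBetti.map φ.hom.hom.hom 1).hom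
      (-(Complex.I * (Real.sqrt d : ℂ)))) = 2 * n := by
    rw [← finrank_eigenspace_eq_finrank_eigenspace_neg hd hφ, hp]
  have hcompl := isCompl_eigenspace_eigenspace_neg hd hφ
  let bp := Module.finBasisOfFinrankEq ℂ _ hp
  let bm := Module.finBasisOfFinrankEq ℂ _ hq
  let b₀ : Module.Basis (Fin (2 * n) ⊕ Fin (2 * n)) ℂ (complexBetti A.X 1) :=
    (bp.prod bm).map (Submodule.prodEquivOfIsCompl _ _ hcompl)
  let b : Module.Basis (Fin (2 * n + 2 * n)) ℂ (complexBetti A.X 1) := b₀.reindex finSumFinEquiv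
  have hb_left : ∀ i : Fin (2 * n), b (Fin.castAdd (2 * n) i) = (bp i : complexBetti A.X 1) := by
    intro i
    rw [Module.Basis.reindex_apply, finSumFinEquiv_symm_apply_castAdd]
    simp only [b₀, Module.Basis.map_apply, Module.Basis.prod_apply, Function.comp_apply,
      LinearMap.inl_apply, Submodule.coe_prodEquivOfIsCompl', Submodule.coe_zero, add_zero, Sum.elim_inl]
  have hb_right : ∀ j : Fin (2 * n), b (Fin.natAdd (2 * n) j) = (bm j : complexBetti A.X 1) := by
    intro j
    rw [Module.Basis.reindex_apply, finSumFinEquiv_symm_apply_natAdd]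
    simp only [b₀, Module.Basis.map_apply, Module.Basis.prod_apply, Function.comp_apply,
      LinearMap.inr_apply, Submodule.coe_prodEquivOfIsCompl', Submodule.coe_zero, zero_add, Sum.elim_inr]
  let v : Fin (2 * n) → complexBetti A.X 1 := fun i => b (Fin.castAdd (2 * n) i)
  let w : Fin (2 * n) → complexBetti A.X 1 := fun j => b (Fin.natAdd (2 * n) j)
  have hvw : Fin.append v w = ⇑b := Fin.append_castAdd_natAdd
  have hne : cupProduct rfl (cupPowOne ℂ (ComplexPoints A.X) (2 * n) v)
      (cupPowOne ℂ (ComplexPoints A.X) (2 * n) w) ≠ 0 := by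
    rw [cupProduct_cupPowOne_cupPowOne, hvw]
    exact cupPowOne_basis_ne_zero hΛ b
  refine ⟨v, w, fun i => ?_, fun j => ?_, ?_, ?_⟩
  · show b (Fin.castAdd (2 * n) i) ∈ _
    rw [hb_left]; exact (bp i).2
  · show b (Fin.natAdd (2 * n) j) ∈ _
    rw [hb_right]; exact (bm j).2
  · intro h0; apply hne; rw [h0, map_zero, LinearMap.zero_apply]
  · intro h0; apply hne; rw [h0, map_zero]

/-- `α = ∏ aᵢ ∈ E₊` for `aᵢ ∈ V₊` (the character of `ℕ[φ]` on `⋀^{2n} V₊` is `(x + iy√d)^{2n}`). -/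
theorem cupPowOne_mem_weilClassesPlus {a : Fin (2 * n) → complexBetti A.X 1}
    (ha : ∀ i, a i ∈ Module.End.eigenspace (complexBetti.map φ.hom.hom.hom 1).hom
      (Complex.I * (Real.sqrt d : ℂ))) :
    cupPowOne ℂ (ComplexPoints A.X) (2 * n) a ∈ weilClassesPlus A φ n d := by
  have h := cupPowOne_mem_pullbackEigenclasses (lam := fun _ => Complex.I * (Real.sqrt d : ℂ)) ha
  rw [mem_weilClassesPlus_iff]
  intro x y
  rw [(mem_pullbackEigenclasses_iff.mp h) x y]
  show (∏ _i : Fin (2 * n), ((x : ℂ) + (y : ℂ) * (Complex.I * (Real.sqrt d : ℂ)))) • _ = _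
  rw [Finset.prod_const, Finset.card_univ, Fintype.card_fin, mul_assoc]

/-- `β = ∏ bⱼ ∈ E₋` for `bⱼ ∈ V₋`. -/
theorem cupPowOne_mem_weilClassesMinus {b : Fin (2 * n) → complexBetti A.X 1}
    (hb : ∀ j, b j ∈ Module.End.eigenspace (complexBetti.map φ.hom.hom.hom 1).hom
      (-(Complex.I * (Real.sqrt d : ℂ)))) :
    cupPowOne ℂ (ComplexPoints A.X) (2 * n) b ∈ weilClassesMinus A φ n d := by
  have h := cupPowOne_mem_pullbackEigenclasses (lam := fun _ => -(Complex.I * (Real.sqrt d : ℂ))) hb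
  rw [mem_weilClassesMinus_iff]
  intro x y
  rw [(mem_pullbackEigenclasses_iff.mp h) x y]
  show (∏ _i : Fin (2 * n), ((x : ℂ) + (y : ℂ) * -(Complex.I * (Real.sqrt d : ℂ)))) • _ = _
  rw [Finset.prod_const, Finset.card_univ, Fintype.card_fin, mul_neg, ← sub_eq_add_neg, mul_assoc]

end Generators

end Summit.HodgeConjecture.HodgeConjecture.Ring2.AbelianAll

end
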